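import Summits.BirchSwinnertonDyer.Rank1Residual.Supersingular.X7VisibilityWitnessShape
import HarnessLib

/-!
# N4 by VISIBILITY — the EXPLICIT-WITNESS shapes, X6 side: X6 ∧ `r_an = 0` ∧ odd `p` ∧ `ord_p #Ш_an ≤ 2` + a `p`-congruent partner `W'` and
# ONE NAMED point `P ∈ W'(ℚ) ∖ pW'(ℚ)`, `p`-divisible in `W'(ℚ_w)` wherever the refined count would have had to pay (x10b gen 26)

Cell `b2b-bsdres`, supersingular family, prover A = unit `b2b-bsdres-x10b` (gen 26), N4 class lead.  Topic file; namespace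
`Summit.BirchSwinnertonDyer.Rank1Residual.Supersingular`.  THEOREMS ONLY (compositions by name); no named fact, no definition, nothing
booked; X6 stays CONSTRUCTION-SHAPED (mark of RESIDUAL-MAP §I N4 unchanged).  The X6 twins of `X7VisibilityWitnessShape.lean` (this gen,
p390757; left out there for the 400-line limit): the local dispatch (`h1Equiv_kummerMapTorsion_mem_selmerLocalKer_of_witness[₆]`) and the visible
element (`exists_sha_ne_zero_of_congr_of_witness[₆]`) are imported; only the two END compositions differ (`ClassX6.irr` and
`X6.bsdp_of_missingLowerBoundAt_of_analyticRank_eq_zero` — no image hypothesis beyond the class — in place of `ClassX7.irr` + `surj(p)` +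
`X7.bsdp_of_missingLowerBoundAt_of_surj`).  First consumer: `X6VisibilityWitnessRecords01.lean` — the N4 cell `270618c1 @ 7` from a GENERATOR of
its level-lowered `7`-congruent partner `7314a1` with the place `7` FREE (kind (v)) and every other place of kind (i): the final binder list
(no rank datum, no Cremona datum) of the gen-25 offer `bsdp_x6r0vis7_270618c1_7` in ONE step.  The N4 residue `130798a1 @ 7`, `399190l1 @ 7`
(no non-isogenous `7`-congruent curve known) is untouched.

HONEST FRAMING (run/shared/lean/b2b/bsd-rank1-residual/, verbatim in every file): the goal of the cell is to
DELETE the COMBINATION-SHAPED residual classes of the Birch–Swinnerton-Dyer formula for ALL analytic-rank `≤ 1`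
elliptic curves over `ℚ` — "full BSD formula for every rank `≤ 1` curve in class `C`" assembled STRICTLY from
published theorems — so that the rank-`≤ 1` remainder becomes exactly the CONSTRUCTION-SHAPED classes, which are
TYPED (missing-input `Prop`s), NOT attempted.  This is not "finishing BSD".

References: Cremona–Mazur 2000 §3 [CremonaMazur2000]; Agashe–Stein 2002 Lemma 3.6 [AgasheStein2002]; Mazur–Rubin 2015 Thm. 3.1
[MazurRubin2015SelmerCompanions]; Fisher 2016 Thm. 4.4 [Fisher2016Visualizing7]; Wuthrich 2014 Prop. 21 [Wuthrich2014]; Silverman AEC X.4.14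
[SilvermanAEC2009]; ATAEC V [SilvermanATAEC1994]; HOME/b2b-bsdres-x10b/X6-KURIHARA.md §26.
-/

set_option autoImplicit false

noncomputable section

open scoped Classical

open WeierstrassCurve Literature.NumberTheory.EllipticCurves
  Literature.NumberTheory.EllipticCurves.Rank1Residual
  Literature.NumberTheory.EllipticCurves.Rank1Residual.Typed
  Literature.NumberTheory.EllipticCurves.Rank1Residual.X11RankOneCertificates
  Literature.NumberTheory.EllipticCurves.Wuthrich2014
  Literature.NumberTheory.EllipticCurves.Fisher2016
  Literature.NumberTheory.EllipticCurves.MazurRubin2015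
  Literature.NumberTheory.GaloisRepresentations
  Summit.BirchSwinnertonDyer.BirchSwinnertonDyer.Rank1Residual.IntModel
  Summit.BirchSwinnertonDyer.Rank1Residual.X11b
  Summit.BirchSwinnertonDyer.Rank1Residual.GaloisImage
open NumberField IsDedekindDomain Rat.HeightOneSpectrum

namespace Summit.BirchSwinnertonDyer.Rank1Residual.Supersingular

/-- **X6 ∩ {r_an = 0} (semistable, good supersingular at `p`), odd `p`, `ord_p #Ш_an ≤ 2`: `BSD(E,p)` from PUBLISHED theorems plus a
`p`-CONGRUENT curve `W'` and ONE WITNESS POINT `P ∈ W'(ℚ) ∖ pW'(ℚ)`** (the X6 twin of `X7RankZero.bsdp_of_casselsTate_of_congr_of_witness₆_of_surj`) that, at every place of `S`, EITHER has a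
`p`-th root in `W'(ℚ_w)` OR sits at a place of one of the five free kinds (i)–(v) of `X7VisibilityShapeFiveKinds`.
NO rank binder, NO count.  Chain: `exists_sha_ne_zero_of_congr_of_witness₆` (`E(ℚ)` finite of order prime to `p` by GZK +
`ClassX6.irr`; no image hypothesis beyond the class) ⟹ `p ∣ #Ш` ⟹ Cassels–Tate squareness ⟹ Wuthrich Prop. 21
(`X6.bsdp_of_missingLowerBoundAt_of_analyticRank_eq_zero`; NO Tamagawa hypothesis).  Per pair; NOT a class theorem.  [cite: CremonaMazur2000, §3 and Table 1] [cite: AgasheStein2002, Lemma 3.6]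
[cite: MazurRubin2015SelmerCompanions, Thm. 3.1 (iv)(b) and §6 Case 5] [cite: Fisher2016Visualizing7, Thm. 4.4 (p. 106)]
[cite: Wuthrich2014, Prop. 21 (p. 400)] [cite: SilvermanATAEC1994, Ch. V Thm. 5.3, Cor. 5.4] [cite: SilvermanAEC2009, Thm. X.4.14] -/
theorem X6RankZero.bsdp_of_casselsTate_of_congr_of_witness₆
    (hCT : exists_casselsTate_pairing (K := ℚ)) (hW : sha_dvd_analyticSha)
    (hGZK : rank_eq_analyticRank_of_analyticRank_le_one) (hmod : hasEntireLFunction_rat)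
    (hU : Silverman1994_thmV53_tateUniformisation.{0})
    (hU2 : Silverman1994_thmV53_corV54_tateUniformisation.{0})
    (hF44 : thm44_selmerLocalKer_iff_of_nonsplit_good) (hMR : selmerLocalKer_iff_of_goodReduction_above)
    (W : WeierstrassCurve ℚ) [W.IsElliptic] [W.IsGloballyMinimal] (p : ℕ) [Fact p.Prime] (hp : p ≠ 2)
    (hX : ClassX6 W p) (hr : W.analyticRank = 0) {q : ℚ} (hq : shaAn W = (q : ℂ)) (hv : padicValRat p q ≤ 2)
    (W' : WeierstrassCurve ℚ) [W'.IsElliptic]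
    (θ : geomTorsion W' (p : ℤ) ≃+ geomTorsion W (p : ℤ))
    (hθ : ∀ (σ : Field.absoluteGaloisGroup ℚ) (P : geomTorsion W' (p : ℤ)), θ (σ • P) = σ • θ P)
    (S : Finset (HeightOneSpectrum (𝓞 ℚ)))
    (hS : ∀ w : HeightOneSpectrum (𝓞 ℚ), w ∉ S →
      W.HasGoodReductionAt w ∧ W'.HasGoodReductionAt w ∧ (p : 𝓞 ℚ) ∉ w.asIdeal)
    (P : W'.toAffine.Point)
    (hP : P ∉ (zsmulAddGroupHom (p : ℤ) : W'.toAffine.Point →+ W'.toAffine.Point).range)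
    (hplaces : ∀ w ∈ S,
      (∃ Q : (W'.baseChange (w.adicCompletion ℚ)).toAffine.Point,
        p • Q = WeierstrassCurve.Affine.Point.baseChange (W' := W') ℚ (w.adicCompletion ℚ) P) ∨
      ((p : 𝓞 ℚ) ∉ w.asIdeal ∧ Nat.card (nsmulAddMonoidHom p :
          (W'.baseChange (w.adicCompletion ℚ)).toAffine.Point →+ _).ker = 1) ∨
      (W.HasSplitMultiplicativeReductionAt w ∧ W'.HasSplitMultiplicativeReductionAt w ∧
        Nat.card (nsmulAddMonoidHom p :
          (W.baseChange (w.adicCompletion ℚ)).toAffine.Point →+ _).ker ≤ p) ∨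
      (W.HasMultiplicativeReductionAt w ∧ W'.HasMultiplicativeReductionAt w ∧
        (∃ r : w.adicCompletion ℚ, algebraMap ℚ (w.adicCompletion ℚ) (-(W.c₄ / W.c₆)) =
          r ^ 2 * algebraMap ℚ (w.adicCompletion ℚ) (-(W'.c₄ / W'.c₆))) ∧
        (∀ ζ : w.adicCompletion ℚ, ζ ^ p = 1 → ζ = 1)) ∨
      ((W.HasMultiplicativeReductionAt w ∧ ¬ W.HasSplitMultiplicativeReductionAt w ∧
          W'.HasGoodReductionAt w) ∨
        (W.HasGoodReductionAt w ∧ W'.HasMultiplicativeReductionAt w ∧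
          ¬ W'.HasSplitMultiplicativeReductionAt w)) ∨
      ((p : 𝓞 ℚ) ∈ w.asIdeal ∧ W.HasGoodReductionAt w ∧ W'.HasGoodReductionAt w)) :
    BSDp W p := by
  haveI hfin : Finite W.toAffine.Point := finite_point_of_analyticRank_eq_zero W hGZK hr
  have hirr : Irr W p := ClassX6.irr W p hp hX
  have hcop : (Nat.card W.toAffine.Point).Coprime p := coprime_natCard_point_of_irr W p hirr
  have hex : ∃ c : W.sha, c ≠ 0 ∧ p • c = 0 :=
    exists_sha_ne_zero_of_congr_of_witness₆ hU hU2 hF44 hMR hp θ hθ S hS hfin hcop P hP hplaces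
  have hfinSha : W.ShaFinite := (hGZK W (by rw [hr]; norm_num)).2
  have hlow : MissingLowerBoundAt W p :=
    missingLowerBoundAt_of_casselsTate_of_pow_dvd W p hCT hfinSha hq (k := 1) (by simpa using hv)
      (by simpa using dvd_shaOrder_of_exists_torsion W p hex)
  exact X6.bsdp_of_missingLowerBoundAt_of_analyticRank_eq_zero W p hW hGZK hmod hp hX hr hlow

/-- **X6 ∩ {r_an = 0}, odd `p`, `ord_p #Ш_an ≤ 2`: `BSD(E,p)` from a `p`-congruent partner and ONE WITNESS POINT — LEAN variant** (X6 twin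
of `X7RankZero.bsdp_of_casselsTate_of_congr_of_witness_of_surj`): every place of `S` is (a) a place where the witness has a `p`-th root in `W'(ℚ_w)`, or (i) `w ∤ p` with
`W'(ℚ_w)[p] = 0`, or (v) the place of `p` with both curves good (Mazur–Rubin).  Named facts: Cassels–Tate, Wuthrich Prop. 21,
GZK, modularity, Mazur–Rubin 2015 — NO Tate uniformisation, NO Fisher 2016, NO rank binder.  Per pair; NOT a class theorem.
[cite: CremonaMazur2000, §3 and Table 1] [cite: AgasheStein2002, Lemma 3.6] [cite: MazurRubin2015SelmerCompanions, Thm. 3.1 (iv)(b) and §6 Case 5]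
[cite: Wuthrich2014, Prop. 21 (p. 400)] [cite: SilvermanAEC2009, Thm. X.4.14] -/
theorem X6RankZero.bsdp_of_casselsTate_of_congr_of_witness
    (hCT : exists_casselsTate_pairing (K := ℚ)) (hW : sha_dvd_analyticSha)
    (hGZK : rank_eq_analyticRank_of_analyticRank_le_one) (hmod : hasEntireLFunction_rat)
    (hMR : selmerLocalKer_iff_of_goodReduction_above)
    (W : WeierstrassCurve ℚ) [W.IsElliptic] [W.IsGloballyMinimal] (p : ℕ) [Fact p.Prime] (hp : p ≠ 2)
    (hX : ClassX6 W p) (hr : W.analyticRank = 0) {q : ℚ} (hq : shaAn W = (q : ℂ)) (hv : padicValRat p q ≤ 2)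
    (W' : WeierstrassCurve ℚ) [W'.IsElliptic]
    (θ : geomTorsion W' (p : ℤ) ≃+ geomTorsion W (p : ℤ))
    (hθ : ∀ (σ : Field.absoluteGaloisGroup ℚ) (P : geomTorsion W' (p : ℤ)), θ (σ • P) = σ • θ P)
    (S : Finset (HeightOneSpectrum (𝓞 ℚ)))
    (hS : ∀ w : HeightOneSpectrum (𝓞 ℚ), w ∉ S →
      W.HasGoodReductionAt w ∧ W'.HasGoodReductionAt w ∧ (p : 𝓞 ℚ) ∉ w.asIdeal)
    (P : W'.toAffine.Point)
    (hP : P ∉ (zsmulAddGroupHom (p : ℤ) : W'.toAffine.Point →+ W'.toAffine.Point).range)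
    (hplaces : ∀ w ∈ S,
      (∃ Q : (W'.baseChange (w.adicCompletion ℚ)).toAffine.Point,
        p • Q = WeierstrassCurve.Affine.Point.baseChange (W' := W') ℚ (w.adicCompletion ℚ) P) ∨
      ((p : 𝓞 ℚ) ∉ w.asIdeal ∧ Nat.card (nsmulAddMonoidHom p :
          (W'.baseChange (w.adicCompletion ℚ)).toAffine.Point →+ _).ker = 1) ∨
      ((p : 𝓞 ℚ) ∈ w.asIdeal ∧ W.HasGoodReductionAt w ∧ W'.HasGoodReductionAt w)) :
    BSDp W p := by
  haveI hfin : Finite W.toAffine.Point := finite_point_of_analyticRank_eq_zero W hGZK hr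
  have hirr : Irr W p := ClassX6.irr W p hp hX
  have hcop : (Nat.card W.toAffine.Point).Coprime p := coprime_natCard_point_of_irr W p hirr
  have hex : ∃ c : W.sha, c ≠ 0 ∧ p • c = 0 :=
    exists_sha_ne_zero_of_congr_of_witness hMR hp θ hθ S hS hfin hcop P hP hplaces
  have hfinSha : W.ShaFinite := (hGZK W (by rw [hr]; norm_num)).2
  have hlow : MissingLowerBoundAt W p :=
    missingLowerBoundAt_of_casselsTate_of_pow_dvd W p hCT hfinSha hq (k := 1) (by simpa using hv)
      (by simpa using dvd_shaOrder_of_exists_torsion W p hex)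
  exact X6.bsdp_of_missingLowerBoundAt_of_analyticRank_eq_zero W p hW hGZK hmod hp hX hr hlow

end Summit.BirchSwinnertonDyer.Rank1Residual.Supersingular

end
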